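import Summits.KontsevichZagierPeriods.Zeta5Search.Barrier.ConeGammaDefs

/-!
# ζ(5) search — BARRIER: the 28 forms as PAIR forms on `ℝ⁸`, and the `S₇` action on them

HONEST FRAMING (cell `pub-zeta5`): systematic search; no irrationality claim unless kernel-certified. MODEL objects
under Brown–Zudilin's (28)+(30) accounting ([BZ22] = arXiv:2210.03391); nothing here is a statement about `ζ(5)`;
records in print UNMOVED. Infrastructure for the cell's `BARRIER-PLAN.md` §2b (item (P1) of the «provable now»
list; theory seat cert-2 g17, WAKE w3 of lead/lit g23), part 1/2 (part 2/2 = `ConeGammaTorus`: the torus saving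
function `𝒩` with `N_a(u) = 𝒩(u·s(a))`, `0 ≤ 𝒩 ≤ 7`, periodicity).

In the symmetric parameters `s = (s₀; s₁,…,s₇)` of BZ §10 the 28 linear forms (26) are exactly the 28 PAIR forms of
`{0,…,7}`: `s_i + s_j` (`1 ≤ i < j`) and `s₀ − s_j` (tree: `ConeGammaDefs.h28_aOfS`), and `σ ∈ S₇ ≅ G` acts by
permuting `s₁,…,s₇` (`permS`), i.e. by permuting the pairs. This file makes that bookkeeping available by name:
* `pairForm θ i j` (symmetric, additive, homogeneous), `phiForm θ := h28 (aOfS θ)`, the tables `fstIdx`, `sndIdx`,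
  `idxOf` with **`phiForm_eq`** (`φ_k = pairForm (fstIdx k) (sndIdx k)`, checked entrywise) and
  `pairForm_eq_phiForm_idxOf`; `allPairs` (the 28 pairs `i < j`) and `sum_univ_fin28_eq_sum_allPairs`;
* `liftPerm σ : Perm (Fin 8)` (fixing `0`), `permS_apply`, `permS_smul`, `permS_add`, **`phiForm_permS`**
  (`φ_k(σ·θ) = pairForm θ (σ̃ (fstIdx k)) (σ̃ (sndIdx k))` — `S₇` permutes the forms);
* **`sum_univ_phiForm_permS`** — every symmetric statistic `Σ_k g(φ_k)` of the 28 forms is `S₇`-invariant (via the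
  off-diagonal double-counting `sum_offDiag_eq_two_nsmul` and `sum_offDiag_comp_perm`); `sum_FIdx_phiForm`,
  `sum_FIdx_phiForm_permS` (the invariant form `Σ_{i∈F} φ_i = 2θ₀ + 4Σθ_j` of `sum_FIdx_h28`);
  `phiForm_smul_sParam`, `phiForm_permS_smul_sParam` (reading the tree's `h28 a`, `h28 (permAct σ a)` along the
  line `θ = u·s(a)`), `phiForm_add`, `pairInt_of_phiForm_int`, `fstIdx_ne_sndIdx`.
-/

noncomputable section

open Finset Set
open scoped Pointwise

namespace Summit.KontsevichZagierPeriods.Zeta5Search.Barrier.ConeGamma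

/-! ### Pair forms on `ℝ⁸` and the `Fin 28` table -/

/-- The pair form of `{i,j} ⊂ {0,…,7}` at `θ ∈ ℝ⁸`: `θ₀ − θ_j` if the pair contains `0`, else `θ_i + θ_j`
(symmetric in `i, j`; the diagonal is never used). -/
def pairForm (θ : Fin 8 → ℝ) (i j : Fin 8) : ℝ :=
  if i = 0 then θ 0 - θ j else if j = 0 then θ 0 - θ i else θ i + θ j

/-- `pairForm` is symmetric. -/
theorem pairForm_comm (θ : Fin 8 → ℝ) (i j : Fin 8) : pairForm θ i j = pairForm θ j i := by
  unfold pairForm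
  split_ifs <;> simp_all [add_comm]

/-- `pairForm` is additive in `θ`. -/
theorem pairForm_add (θ ζ : Fin 8 → ℝ) (i j : Fin 8) :
    pairForm (θ + ζ) i j = pairForm θ i j + pairForm ζ i j := by
  unfold pairForm
  split_ifs <;> simp <;> ring

/-- `pairForm` is homogeneous in `θ`. -/
theorem pairForm_smul (c : ℝ) (θ : Fin 8 → ℝ) (i j : Fin 8) :
    pairForm (c • θ) i j = c * pairForm θ i j := by
  unfold pairForm
  split_ifs <;> simp <;> ring

/-- The 28 forms of (26) read on `ℝ⁸` through the symmetric parameters: `φ(θ) := h(a(θ))`. -/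
def phiForm (θ : Fin 8 → ℝ) : Fin 28 → ℝ := h28 (aOfS θ)

/-- First index of the pair of form `k` (table; `0`-based pairs of `Fin 8`, smaller index first). -/
def fstIdx : Fin 28 → Fin 8 :=
  ![1, 0, 2, 0, 3, 5, 6, 3, 1, 1, 1, 0, 0, 2, 0, 2, 0, 2, 4, 3, 1, 1, 3, 0, 4, 2, 5, 4]

/-- Second index of the pair of form `k`. -/
def sndIdx : Fin 28 → Fin 8 :=
  ![2, 2, 3, 3, 4, 6, 7, 5, 3, 4, 5, 4, 5, 6, 1, 4, 6, 5, 6, 7, 6, 7, 6, 7, 5, 7, 7, 7]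

/-- Inverse table: the form index of the pair `(i, j)`, `i < j` (entries with `j ≤ i` are unused fillers). -/
def idxOf : Fin 8 → Fin 8 → Fin 28 :=
  ![![0, 14, 1, 3, 11, 12, 16, 23], ![0, 0, 0, 8, 9, 10, 20, 21], ![0, 0, 0, 2, 15, 17, 13, 25],
    ![0, 0, 0, 0, 4, 7, 22, 19], ![0, 0, 0, 0, 0, 24, 18, 27], ![0, 0, 0, 0, 0, 0, 5, 26],
    ![0, 0, 0, 0, 0, 0, 0, 6], ![0, 0, 0, 0, 0, 0, 0, 0]]

/-- The set of index pairs `i < j` of `Fin 8` (28 of them). -/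
def allPairs : Finset (Fin 8 × Fin 8) := Finset.univ.filter fun p => p.1 < p.2

/-- **The table is right**: form `k` of (26), in symmetric parameters, is the pair form of `(fstIdx k, sndIdx k)`. -/
theorem phiForm_eq (θ : Fin 8 → ℝ) (k : Fin 28) : phiForm θ k = pairForm θ (fstIdx k) (sndIdx k) := by
  fin_cases k <;> simp [phiForm, h28, aOfS, pairForm, fstIdx, sndIdx] <;> ring

/-- `σ ∈ S₇` as a permutation of `Fin 8 = {0} ⊔ {1,…,7}` fixing `0`. -/
def liftPerm (σ : Equiv.Perm (Fin 7)) : Equiv.Perm (Fin 8) where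
  toFun i := Fin.cases 0 (fun j => (σ j).succ) i
  invFun i := Fin.cases 0 (fun j => (σ.symm j).succ) i
  left_inv i := by refine Fin.cases ?_ (fun j => ?_) i <;> simp
  right_inv i := by refine Fin.cases ?_ (fun j => ?_) i <;> simp

/-- `σ̃ 0 = 0`. -/
@[simp] theorem liftPerm_zero (σ : Equiv.Perm (Fin 7)) : liftPerm σ 0 = 0 := rfl

/-- `σ̃ (j+1) = σ(j)+1`. -/
@[simp] theorem liftPerm_succ (σ : Equiv.Perm (Fin 7)) (j : Fin 7) : liftPerm σ j.succ = (σ j).succ := rfl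

/-- Numeral form of `liftPerm_succ` (for `simp` on the tables). -/
@[simp] theorem liftPerm_one (σ : Equiv.Perm (Fin 7)) : liftPerm σ 1 = (σ 0).succ := rfl
/-- Numeral form of `liftPerm_succ`. -/
@[simp] theorem liftPerm_two (σ : Equiv.Perm (Fin 7)) : liftPerm σ 2 = (σ 1).succ := rfl
/-- Numeral form of `liftPerm_succ`. -/
@[simp] theorem liftPerm_three (σ : Equiv.Perm (Fin 7)) : liftPerm σ 3 = (σ 2).succ := rfl
/-- Numeral form of `liftPerm_succ`. -/
@[simp] theorem liftPerm_four (σ : Equiv.Perm (Fin 7)) : liftPerm σ 4 = (σ 3).succ := rfl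
/-- Numeral form of `liftPerm_succ`. -/
@[simp] theorem liftPerm_five (σ : Equiv.Perm (Fin 7)) : liftPerm σ 5 = (σ 4).succ := rfl
/-- Numeral form of `liftPerm_succ`. -/
@[simp] theorem liftPerm_six (σ : Equiv.Perm (Fin 7)) : liftPerm σ 6 = (σ 5).succ := rfl
/-- Numeral form of `liftPerm_succ`. -/
@[simp] theorem liftPerm_seven (σ : Equiv.Perm (Fin 7)) : liftPerm σ 7 = (σ 6).succ := rfl

/-- `liftPerm σ i = 0 ↔ i = 0`. -/
@[simp] theorem liftPerm_eq_zero (σ : Equiv.Perm (Fin 7)) (i : Fin 8) : liftPerm σ i = 0 ↔ i = 0 := by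
  refine Fin.cases ?_ (fun j => ?_) i
  · simp
  · simp [Fin.succ_ne_zero]

/-- `permS` is the pull-back along `liftPerm`: `(σ·s)_i = s_{σ̃ i}`. -/
theorem permS_apply (σ : Equiv.Perm (Fin 7)) (s : Fin 8 → ℝ) (i : Fin 8) : permS σ s i = s (liftPerm σ i) := by
  refine Fin.cases ?_ (fun j => ?_) i
  · simp [permS]
  · simp [permS]

/-- `permS` is linear (scalars). -/
theorem permS_smul (σ : Equiv.Perm (Fin 7)) (c : ℝ) (s : Fin 8 → ℝ) : permS σ (c • s) = c • permS σ s := by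
  ext i; simp [permS_apply]

/-- `permS` is linear (sums). -/
theorem permS_add (σ : Equiv.Perm (Fin 7)) (s s' : Fin 8 → ℝ) : permS σ (s + s') = permS σ s + permS σ s' := by
  ext i; simp [permS_apply]

/-- Pair forms of a permuted vector: `pairForm (σ·θ) i j = pairForm θ (σ̃ i) (σ̃ j)`. -/
theorem pairForm_permS (σ : Equiv.Perm (Fin 7)) (θ : Fin 8 → ℝ) (i j : Fin 8) :
    pairForm (permS σ θ) i j = pairForm θ (liftPerm σ i) (liftPerm σ j) := by
  simp only [pairForm, permS_apply, liftPerm_eq_zero, liftPerm_zero]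

/-- **`S₇` permutes the 28 forms**: `φ_k(σ·θ) = pairForm θ (σ̃ (fstIdx k)) (σ̃ (sndIdx k))`. -/
theorem phiForm_permS (σ : Equiv.Perm (Fin 7)) (θ : Fin 8 → ℝ) (k : Fin 28) :
    phiForm (permS σ θ) k = pairForm θ (liftPerm σ (fstIdx k)) (liftPerm σ (sndIdx k)) := by
  rw [phiForm_eq, pairForm_permS]

/-- `φ(u·s(a))_k = u·h_k(a)`. -/
theorem phiForm_smul_sParam (u : ℝ) (a : Dir) (k : Fin 28) : phiForm (u • sParam a) k = u * h28 a k := by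
  simp only [phiForm, aOfS_smul, aOfS_sParam, h28_smul, Pi.smul_apply, smul_eq_mul]

/-- `φ(σ·(u·s(a)))_k = u·h_k(σa)`. -/
theorem phiForm_permS_smul_sParam (σ : Equiv.Perm (Fin 7)) (u : ℝ) (a : Dir) (k : Fin 28) :
    phiForm (permS σ (u • sParam a)) k = u * h28 (permAct σ a) k := by
  simp only [phiForm, permS_smul, aOfS_smul, h28_smul, Pi.smul_apply, smul_eq_mul, permAct]

/-! ### Sums over the 28 forms are sums over pairs; `S₇`-invariance of symmetric statistics -/

/-- A sum over the 28 form indices is the sum over the index pairs `i < j`. -/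
theorem sum_univ_fin28_eq_sum_allPairs {M : Type*} [AddCommMonoid M] (G : Fin 8 → Fin 8 → M) :
    ∑ k : Fin 28, G (fstIdx k) (sndIdx k) = ∑ p ∈ allPairs, G p.1 p.2 := by
  refine Finset.sum_bij' (fun k _ => (fstIdx k, sndIdx k)) (fun p _ => idxOf p.1 p.2) ?_ ?_ ?_ ?_ ?_
  · intro k _; revert k; decide
  · intro p _; exact Finset.mem_univ _
  · intro k _; revert k; decide
  · intro p hp
    have h : ∀ q ∈ allPairs, (fstIdx (idxOf q.1 q.2), sndIdx (idxOf q.1 q.2)) = q := by decide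
    exact h p hp
  · intro k _; rfl

/-- Relabelling the off-diagonal pairs by a permutation. -/
theorem sum_offDiag_comp_perm {M : Type*} [AddCommMonoid M] (e : Equiv.Perm (Fin 8)) (G : Fin 8 → Fin 8 → M) :
    ∑ p ∈ (Finset.univ : Finset (Fin 8)).offDiag, G (e p.1) (e p.2) =
      ∑ p ∈ (Finset.univ : Finset (Fin 8)).offDiag, G p.1 p.2 := by
  refine Finset.sum_equiv (e.prodCongr e) (fun p => ?_) (fun p _ => rfl)
  simp [Finset.mem_offDiag, e.injective.eq_iff]

/-- For a symmetric `G`, the off-diagonal sum is twice the sum over `i < j`. -/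
theorem sum_offDiag_eq_two_nsmul {M : Type*} [AddCommMonoid M] (G : Fin 8 → Fin 8 → M)
    (hG : ∀ i j, G i j = G j i) :
    ∑ p ∈ (Finset.univ : Finset (Fin 8)).offDiag, G p.1 p.2 = 2 • ∑ p ∈ allPairs, G p.1 p.2 := by
  have hsplit : (Finset.univ : Finset (Fin 8)).offDiag =
      allPairs ∪ Finset.univ.filter (fun p : Fin 8 × Fin 8 => p.2 < p.1) := by
    ext p
    simp only [Finset.mem_offDiag, Finset.mem_univ, true_and, allPairs, Finset.mem_union, Finset.mem_filter]
    exact ⟨fun h => lt_or_gt_of_ne h, fun h => h.elim ne_of_lt ne_of_gt⟩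
  have hdisj : Disjoint allPairs (Finset.univ.filter (fun p : Fin 8 × Fin 8 => p.2 < p.1)) := by
    rw [Finset.disjoint_left]
    intro p hp hq
    simp only [allPairs, Finset.mem_filter, Finset.mem_univ, true_and] at hp hq
    exact lt_asymm hp hq
  have hswap : ∑ p ∈ Finset.univ.filter (fun p : Fin 8 × Fin 8 => p.2 < p.1), G p.1 p.2 =
      ∑ p ∈ allPairs, G p.1 p.2 := by
    refine Finset.sum_equiv (Equiv.prodComm (Fin 8) (Fin 8)) (fun p => ?_) (fun p _ => ?_)
    · simp [allPairs]
    · simp [hG]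
  rw [hsplit, Finset.sum_union hdisj, hswap, two_nsmul]

/-- **Symmetric pair statistics are `S₈`-invariant** (used with `liftPerm σ`). -/
theorem sum_allPairs_comp_perm {M : Type*} [AddCommMonoid M] (e : Equiv.Perm (Fin 8)) (G : Fin 8 → Fin 8 → M)
    (hG : ∀ i j, G i j = G j i) :
    2 • ∑ p ∈ allPairs, G (e p.1) (e p.2) = 2 • ∑ p ∈ allPairs, G p.1 p.2 := by
  rw [← sum_offDiag_eq_two_nsmul G hG, ← sum_offDiag_eq_two_nsmul (fun i j => G (e i) (e j)) fun i j => hG _ _,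
    sum_offDiag_comp_perm e G]

/-- **Every symmetric statistic of the 28 forms is `S₇`-invariant**: `Σ_k g(φ_k(σθ)) = Σ_k g(φ_k θ)`. -/
theorem sum_univ_phiForm_permS (g : ℝ → ℝ) (σ : Equiv.Perm (Fin 7)) (θ : Fin 8 → ℝ) :
    ∑ k : Fin 28, g (phiForm (permS σ θ) k) = ∑ k : Fin 28, g (phiForm θ k) := by
  simp_rw [phiForm_permS, phiForm_eq]
  rw [sum_univ_fin28_eq_sum_allPairs (fun i j => g (pairForm θ (liftPerm σ i) (liftPerm σ j))),
    sum_univ_fin28_eq_sum_allPairs (fun i j => g (pairForm θ i j))]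
  have h := sum_allPairs_comp_perm (M := ℝ) (liftPerm σ) (fun i j => g (pairForm θ i j))
    (fun i j => by rw [pairForm_comm])
  simpa [two_nsmul, ← two_mul] using h

/-- The `S₇`-invariant linear form `Σ_{i∈F} φ_i = 2θ₀ + 4Σθ_j` (`sum_FIdx_h28` on `ℝ⁸`). -/
theorem sum_FIdx_phiForm (θ : Fin 8 → ℝ) : ∑ i ∈ FIdx, phiForm θ i = 2 * θ 0 + 4 * ∑ j : Fin 7, θ j.succ := by
  have h := sum_FIdx_h28 (aOfS θ)
  simpa [phiForm, sParam_aOfS] using h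

/-- `Σ_{i∈F} φ_i(σθ) = Σ_{i∈F} φ_i(θ)`. -/
theorem sum_FIdx_phiForm_permS (σ : Equiv.Perm (Fin 7)) (θ : Fin 8 → ℝ) :
    ∑ i ∈ FIdx, phiForm (permS σ θ) i = ∑ i ∈ FIdx, phiForm θ i := by
  rw [sum_FIdx_phiForm, sum_FIdx_phiForm]
  simp only [permS_apply, liftPerm_zero, liftPerm_succ]
  congr 1
  congr 1
  exact Equiv.sum_comp σ (fun j => θ j.succ)

/-! ### Additivity and integrality transfer -/

/-- The two indices of a tabulated pair are distinct. -/
theorem fstIdx_ne_sndIdx (k : Fin 28) : fstIdx k ≠ sndIdx k := by revert k; decide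

/-- `phiForm` is additive. -/
theorem phiForm_add (θ ζ : Fin 8 → ℝ) (k : Fin 28) : phiForm (θ + ζ) k = phiForm θ k + phiForm ζ k := by
  rw [phiForm_eq, phiForm_eq, phiForm_eq, pairForm_add]

/-- For `i < j` the pair form is the tabulated form `idxOf i j`. -/
theorem pairForm_eq_phiForm_idxOf (θ : Fin 8 → ℝ) {i j : Fin 8} (hij : i < j) :
    pairForm θ i j = phiForm θ (idxOf i j) := by
  have h : ∀ i j : Fin 8, i < j → fstIdx (idxOf i j) = i ∧ sndIdx (idxOf i j) = j := by decide
  obtain ⟨h1, h2⟩ := h i j hij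
  rw [phiForm_eq, h1, h2]

/-- If the 28 forms of `ζ` are integers then so is every pair form `pairForm ζ i j`, `i ≠ j`. -/
theorem pairInt_of_phiForm_int {ζ : Fin 8 → ℝ} (hk : ∀ k, ∃ z : ℤ, phiForm ζ k = z) :
    ∀ i j, i ≠ j → ∃ z : ℤ, pairForm ζ i j = z := by
  intro i j hij
  rcases lt_or_gt_of_ne hij with h | h
  · rw [pairForm_eq_phiForm_idxOf ζ h]; exact hk _
  · rw [pairForm_comm, pairForm_eq_phiForm_idxOf ζ h]; exact hk _

end Summit.KontsevichZagierPeriods.Zeta5Search.Barrier.ConeGamma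

end
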